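import Mathlib
import Literature.Barriers.ValiantsHypothesis.AlgebraicNaturalProofs
import Literature.Computability.AlgebraicComplexity.DeterminantalComplexity
import Literature.Computability.AlgebraicComplexity.DeterminantalComplexityProofs
import Summits.ValiantsHypothesis.ValiantsHypothesis.Theorems.DetqpThesis.Negative.IffPerNotVQP
import HarnessLib

/-!
# Crux `BarrierLever.SuccinctHittingSetsForVP` (stmt-ValiantsHypothesis-14610) — THE SECOND DISJUNCT OF
# THE DOOR (D-0053): an Aaronson–Drucker-type hypothesis ("VBP-succinct hitting sets") IMPLIES Question 6

Lean text authored by the cell planner seat `valiant-natproofs-p1` (gen 3, HOME/p1/Chain3AD.lean),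
landed by the prover seat as a helper of the crux (namespace moved under the crux; no mirrors were
needed). Unconditional implication; does NOT close the item.

The door of record (D-0053) reads: «… CONDITIONAL on a succinct-generator / algebraic-PRF-type
conjecture (FSV Question 6 `SuccinctHittingSetsForVP ℂ` itself, or an Aaronson–Drucker-type algebraic
PRF hypothesis)». Here the Aaronson–Drucker-type hypothesis is typed in the FSV framework — in its
hitting form and with FSV's degree correction (determinant/IMM-based pseudorandom families =
coefficient vectors of degree-`≤ n` polynomials of polynomial DETERMINANTAL complexity, the class
`SmallDet n b` = "`VBP_{n,b}`") — as an explicit hypothesis ("VBP-succinct hitting sets exist"), and placed: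
`succinctHittingSetsForVP_of_forVBP : (VBP-succinct hitting sets exist) → SuccinctHittingSetsForVP ℂ`
(PROVED: `VBP_{n,b} ⊆ VP_{n,7b+11}` by Berkowitz, tree `complexity_le_of_determinantalComplexity`,
and hitting is monotone in the class). So the second disjunct is a SUFFICIENT condition for the first:
the door is conditional on Question 6 (the weakest form). The converse is not claimed.

WHAT THIS IS NOT: not a route, not a lower bound, no claim about the truth of either hypothesis.

References: [ForbesShpilkaVolk2018] §1.3–1.4, §3; [MignonRessayre2004] §1 (determinantal complexity);
[Burgisser2000] Rem. 2.7.
-/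

-- layout Summits/ValiantsHypothesis/ValiantsHypothesis forces the duplicated namespace component
set_option linter.dupNamespace false

noncomputable section

namespace Summit.ValiantsHypothesis.ValiantsHypothesis.Theorems.BarrierLever.SuccinctHittingSetsForVP

namespace ADDoor

open Literature.Barriers.ValiantsHypothesis Literature.Computability.AlgebraicComplexity MvPolynomial
open Summit.ValiantsHypothesis.Theorems.DetqpThesis.Negative (complexity_le_of_determinantalComplexity)

/-- The VBP-type simple class `VBP_{n,b}`: degree `≤ n` and determinantal complexity `≤ n^b`
(affine determinantal representations; `dc` is attained and `HasDetRepr f m ↔ dc f ≤ m`, tree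
`hasDetRepr_iff_determinantalComplexity_le_holds`, so there is no junk value here).
[cite: MignonRessayre2004, §1] -/
def SmallDet (n b : ℕ) : Set (MvPolynomial (Fin n) ℂ) :=
  {f | f.totalDegree ≤ n ∧ determinantalComplexity f ≤ n ^ b}

/-! **The Aaronson–Drucker-type door** ("VBP-succinct hitting sets exist", FSV §1.3/§3, degree-
corrected) is the Prop `∀ a, ∃ b n₀, ∀ n ≥ n₀, IsSuccinctHittingSet (degLEMonomials n) (SmallDet n b)
(Distinguishers ℂ n a)`. It is OPEN and is NOT declared here as a parameterless `def … : Prop` (the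
gate relocates such definitions to `Literature/` as named facts, and an open hypothesis is not a fact);
per D-0059 it is filed as a STATEMENT ITEM of route BarrierLever with exactly this signature. The
theorem below takes it as an explicit hypothesis. -/

/-- Arithmetic: `8(m+1)^7 + m²(2n+1) ≤ n^(7b+11)` for `m ≤ n^b`, `n ≥ 3`. [folklore] -/
theorem det_bound_arith {n b m : ℕ} (hn : 3 ≤ n) (hm : m ≤ n ^ b) :
    8 * (m + 1) ^ 7 + m ^ 2 * (2 * n + 1) ≤ n ^ (7 * b + 11) := by
  have hnb : 1 ≤ n ^ b := Nat.one_le_pow _ _ (by omega)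
  have h1 : m + 1 ≤ n ^ (b + 1) := by
    calc m + 1 ≤ n ^ b + n ^ b := Nat.add_le_add hm hnb
      _ = 2 * n ^ b := by ring
      _ ≤ n * n ^ b := Nat.mul_le_mul_right _ (by omega)
      _ = n ^ (b + 1) := by ring
  have h2 : (m + 1) ^ 7 ≤ n ^ (7 * b + 7) := by
    calc (m + 1) ^ 7 ≤ (n ^ (b + 1)) ^ 7 := Nat.pow_le_pow_left h1 7
      _ = n ^ (7 * b + 7) := by rw [← pow_mul]; ring_nf
  have h8 : 8 ≤ n ^ 3 := by
    calc 8 = 2 ^ 3 := by norm_num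
      _ ≤ n ^ 3 := Nat.pow_le_pow_left (by omega) 3
  have hA : 8 * (m + 1) ^ 7 ≤ n ^ (7 * b + 10) := by
    calc 8 * (m + 1) ^ 7 ≤ n ^ 3 * n ^ (7 * b + 7) := Nat.mul_le_mul h8 h2
      _ = n ^ (7 * b + 10) := by rw [← pow_add]; ring_nf
  have h3 : 2 * n + 1 ≤ n ^ 2 := by nlinarith
  have hB : m ^ 2 * (2 * n + 1) ≤ n ^ (7 * b + 10) := by
    calc m ^ 2 * (2 * n + 1) ≤ (n ^ b) ^ 2 * n ^ 2 := Nat.mul_le_mul (Nat.pow_le_pow_left hm 2) h3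
      _ = n ^ (2 * b + 2) := by rw [← pow_mul, ← pow_add]; ring_nf
      _ ≤ n ^ (7 * b + 10) := Nat.pow_le_pow_right (by omega) (by omega)
  calc 8 * (m + 1) ^ 7 + m ^ 2 * (2 * n + 1) ≤ n ^ (7 * b + 10) + n ^ (7 * b + 10) :=
        Nat.add_le_add hA hB
    _ = 2 * n ^ (7 * b + 10) := by ring
    _ ≤ n * n ^ (7 * b + 10) := Nat.mul_le_mul_right _ (by omega)
    _ = n ^ (7 * b + 11) := by ring

/-- **`VBP_{n,b} ⊆ VP_{n,7b+11}`** for `n ≥ 3` (Berkowitz: `L(DET_m) ≤ 8(m+1)^7`, tree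
`complexity_detPoly_le`, plus the affine substitution). [cite: Burgisser2000, Rem. 2.7] -/
theorem smallDet_subset_smallCircuits {n : ℕ} (hn : 3 ≤ n) (b : ℕ) :
    SmallDet n b ⊆ SmallCircuits ℂ n (7 * b + 11) := by
  rintro f ⟨hdeg, hdc⟩
  refine ⟨hdeg, ?_⟩
  refine (complexity_le_of_determinantalComplexity f).trans ?_
  have hcard : Fintype.card (Fin n) = n := Fintype.card_fin n
  rw [hcard]
  exact det_bound_arith hn hdc

/-- **AD-type ⟹ Question 6**: VBP-succinct hitting sets (the hypothesis `h`, "for every level `a`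
some `VBP_{n,b}` hits the level-`a` distinguishers eventually") are in particular VP-succinct hitting
sets. The second disjunct of the D-0053 door is a sufficient condition for the first.
[cite: ForbesShpilkaVolk2018, §1.3] -/
theorem succinctHittingSetsForVP_of_forVBP
    (h : ∀ a : ℕ, ∃ b n₀ : ℕ, ∀ n : ℕ, n₀ ≤ n →
      IsSuccinctHittingSet (degLEMonomials n) (SmallDet n b) (Distinguishers ℂ n a)) :
    SuccinctHittingSetsForVP ℂ := by
  intro a
  obtain ⟨b, n₀, hhit⟩ := h a
  refine ⟨7 * b + 11, max n₀ 3, fun n hn => ?_⟩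
  have hn₀ : n₀ ≤ n := (le_max_left _ _).trans hn
  have hn3 : 3 ≤ n := (le_max_right _ _).trans hn
  exact (hhit n hn₀).mono (smallDet_subset_smallCircuits hn3 b) le_rfl


end ADDoor

end Summit.ValiantsHypothesis.ValiantsHypothesis.Theorems.BarrierLever.SuccinctHittingSetsForVP

end
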